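import Summits.CriticalPhenomena.CardyFormulaZ2.Theorems.CardySelfDualSegmentUniformBoxCrossingEngine
import Summits.CriticalPhenomena.CardyFormulaZ2.Theorems.CardySelfDualSegmentUniformBoxCrossingKernelNecessary
import HarnessLib

/-!
# `UniformBoxCrossing` ⟺ the t-uniform Non-Slant lemma (crux stmt-CriticalPhenomena-5476, line `Sketch`)

The landed engine `uniformBoxCrossing_of_nonSlant : NonSlantStatement → UniformBoxCrossing`
(Bollobás–Riordan 2010 §5.1, translation-only, transplanted to the corner product measure) and the
landed converse `nonSlant_of_uniformBoxCrossing` (a vertical crossing of the thin rectangle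
`[0, ⌊3n/5⌋] × [0, n]`, controlled by the box-crossing bounds at `ρ = 3`, is a non-slant crossing of
the square) combine into ONE equivalence: in Lean the crux
`Summit.CriticalPhenomena.CardyFormulaZ2.Theses.CardySelfDualSegment.UniformBoxCrossing` is EXACTLY
the kernel statement `NonSlantStatement` of `Theorems/CardySelfDualSegmentUniformBoxCrossingDefs2.lean`
(t-uniform Bollobás–Riordan Lemma 5.2 without the mirror). This is the statement the line lead hands
back for promotion (`promote-stub: stub_nonSlant`): nothing weaker than the crux closes the line, and
nothing of the crux is lost by working on the kernel alone.
-/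

namespace Summit.CriticalPhenomena.CardyFormulaZ2.Cruxes.UniformBoxCrossing.NonSlantLine

open Summit.CriticalPhenomena.CardyFormulaZ2.Theses.CardySelfDualSegment

/-- **Crux ⟺ kernel**: `UniformBoxCrossing ↔ NonSlantStatement` (engine `uniformBoxCrossing_of_nonSlant`
+ converse `nonSlant_of_uniformBoxCrossing`). [cite: BollobasRiordan2010, §5.1 Lemma 5.2 and Thm. 5.3] -/
theorem uniformBoxCrossing_iff_nonSlant : UniformBoxCrossing ↔ NonSlantStatement :=
  ⟨fun h => nonSlant_of_uniformBoxCrossing h, uniformBoxCrossing_of_nonSlant⟩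

end Summit.CriticalPhenomena.CardyFormulaZ2.Cruxes.UniformBoxCrossing.NonSlantLine
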